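import Literature.IUT.HodgeTheaters.PuncturedEllipticCoveringsCor12Assembly
import HarnessLib

/-!
# [IUTchI] Corollary 1.2, the resp'd case `Π_{C̲→}`: `Π_C̲ = Π_{C̲→} · H` and the assembly — proof-only

Mochizuki, *Inter-universal Teichmüller theory I*, kurims manuscript (May 2020), §1, Corollary 1.2
"Characteristic Nature of Coverings", statement and PROOF p. 39 ([IUTchI] Cor 1.2 p.39)
[claim: Mochizuki2012, status: disputed]: "For simplicity, we consider the non-resp'd case; the resp'd
case is entirely similar [but slightly easier]."  Node `IUTchI:Cor1.2`; proof-only companion (no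
definitions, nothing restated) over abc-iut-L5-t1's FROZEN `PuncturedEllipticCoverings.lean` /
`…Cusps.lean` / `…CuspsProofs.lean` and the abc-iut-L5-d4 kernels `…Characteristic`, `…Cores`,
`…CuspRecovery`, `…Splitting`, `…XbarRecovery`, `…CuspTransport`, `…Cor12Assembly`.

THE RESP'D CASE (reconstruct `Π_C̲` and the class of the decomposition groups of `{ε̲}` from `Π_{C̲→}`),
along the same route with the same printed anabelian inputs as hypotheses (never asserted): the core
isomorphism `Θ : Π_C ⥲ Π'_C` extending `ψ : Π_{C̲→} ⥲ Π'_{C̲→}` with `Θ(Δ_X) = Δ'_X`, `Θ(Δ_C) = Δ'_C`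
[slimness, [AbsTopI] Thm. 2.6 (v)(vi), [AbsTopII] Cor. 3.3 (i)(ii)], and the transport of cuspidal
decomposition groups [[AbsTopI] Lem. 4.5 as AMENDED for orbicurves by Rmk. 1.2.2 (ii)], here for
`C̲`: the decomposition groups in `Π_C̲` of the cusps of `C̲` other than the cusp `ε̲⁰` under `ε⁰` are
the `D_x`, `x ≠ ε⁰` (such cusps split in `X̲ → C̲`), and the hypothesis `hLem45C` says that a
bicontinuous `Θ` with `Θ(Π_C̲) = Π'_C̲` carries their `Π_C̲`-conjugacy classes onto the corresponding
classes for `C̲'` (both directions).  [READING NOTE: Lem. 4.5 for `C̲` concerns ALL cusps of `C̲`; the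
cusp `ε̲⁰` is told apart group-theoretically as the one whose inertia group does NOT lie in `Δ_X`
(`ε⁰` is ramified in `X̲ → C̲`, the other cusps split), `Δ_X` being among the reconstructed data — but
the frozen record carries only `D_{ε⁰} = D_{ε̲⁰} ∩ Π_X̲`, not `D_{ε̲⁰}`, so the hypothesis is READ on the
cusps `x ≠ ε⁰`; nothing is asserted.]  KERNELS ("[slightly easier]": no splitting step is needed):
* `ArrowCoveringClaims.piXbar_sup_piCarrow_eq_piCbar` — `Π_X̲ · Π_{C̲→} = Π_C̲` (indices `2` and `l`
  coprime); hence **`ArrowCoveringClaims.piCarrow_sup_H_eq_piCbar` — `Π_C̲ = Π_{C̲→} · H`** with the SAME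
  `H = Ker(Δ_X ↠ Δ_X^{ab} ⊗ ℤ/lℤ)` as in the non-resp'd case (`Π_X̲ = Π_{X̲→}·H`, p429979);
* `relIndex_deltaCarrow_deltaC` — `[Δ_C : Δ_{C̲→}] = l²`, so `l` is recovered from `Π_{C̲→} ⊆ Π_C ⊇ Δ_C`
  (`l_eq_of_map_piCarrow_deltaC`), and `Θ(Π_C̲) = Π'_C̲` for any bicontinuous `Θ` carrying
  `Π_{C̲→}, Δ_X, Δ_C` onto their counterparts (`map_piCbar_eq_of_map_piCarrow`);
* the ramification criterion in `C̲→ → C̲`: `I_x ⊆ Π_{C̲→} ↔ I_x ⊆ Π_{X̲→}` (`Π_{C̲→} ∩ Δ_X̲ = jKer`), its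
  transport, and `{ε′, ε″} ↦ {ε′', ε″'}` among the cusps `≠ ε⁰`;
* **`ofCarrow_of_anabelian`** (the resp'd clause of `CharacteristicNatureOfCoverings`) and
  **`characteristicNatureOfCoverings_of_anabelian'`** — the typed Corollary 1.2 with BOTH clauses
  derived from printed-shape inputs (`hcore`/`hLem45` for `X̲→`, `hcoreC`/`hLem45C` for `C̲→`, the
  printed claims of p. 38, the cusp actions, the law `[Π_X : Π_X̲] = l`, and the printed ramification of
  `ε⁰`, both sides).
No side is taken on [IUTchIII] Cor. 3.12; typed ≠ discharged for the anabelian inputs.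
-/

namespace Literature.IUT.HodgeTheaters

namespace PuncturedEllipticData

open scoped Pointwise
open Literature.AnabelianGeometry.AbsoluteAnabelian

universe u

variable {D D' : PuncturedEllipticData.{u}}

/-! ### `Π_C̲ = Π_{C̲→} · H` -/

/-- `Π_X̲ · Π_{C̲→} = Π_C̲`: the join has index dividing `[Π_C̲ : Π_X̲] = 2` and `[Π_C̲ : Π_{C̲→}] = l`,
which are coprime (`l` is prime to `6`). ([IUTchI] Cor 1.2 p.39) [claim: Mochizuki2012, status: disputed] -/
theorem ArrowCoveringClaims.piXbar_sup_piCarrow_eq_piCbar (h : D.ArrowCoveringClaims) :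
    D.PiXbar ⊔ D.piCarrow = D.PiCbar := by
  have hle : D.PiXbar ⊔ D.piCarrow ≤ D.PiCbar := sup_le D.piXbar_le_piCbar D.piCarrow_le_piCbar
  refine le_antisymm hle (Subgroup.relIndex_eq_one.mp ?_)
  have h2 : (D.PiXbar ⊔ D.piCarrow).relIndex D.PiCbar ∣ 2 :=
    h.relIndex_piXbar ▸ Subgroup.relIndex_dvd_of_le_left D.PiCbar le_sup_left
  have hl : (D.PiXbar ⊔ D.piCarrow).relIndex D.PiCbar ∣ D.l :=
    h.piCarrow_relindex ▸ Subgroup.relIndex_dvd_of_le_left D.PiCbar le_sup_right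
  have hcop : Nat.Coprime D.l 2 := Nat.Coprime.coprime_dvd_right (by norm_num) D.coprime_six
  have hdvd : (D.PiXbar ⊔ D.piCarrow).relIndex D.PiCbar ∣ Nat.gcd D.l 2 := Nat.dvd_gcd hl h2
  rw [Nat.Coprime.gcd_eq_one hcop] at hdvd
  exact Nat.dvd_one.mp hdvd

/-- **"`Π_C̲ = Π_{C̲→} · H`"**, `H = Ker(Δ_X ↠ Δ_X^{ab} ⊗ ℤ/lℤ)` (the closed subgroup of the frozen
hypothesis (∗) `star`): the resp'd analogue of `Π_X̲ = Π_{X̲→} · H`, under the printed claims of p. 38, the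
cusp action and the law `[Π_X : Π_X̲] = l` [`Π_{C̲→}·H ⊇ Π_{X̲→}·H = Π_X̲` and `Π_X̲·Π_{C̲→} = Π_C̲`].
([IUTchI] Cor 1.2 p.39) [claim: Mochizuki2012, status: disputed] -/
theorem ArrowCoveringClaims.piCarrow_sup_H_eq_piCbar (h : D.ArrowCoveringClaims) (C : D.CuspGalois)
    (hX : D.PiXbar.relIndex D.PiX = D.l) :
    D.piCarrow ⊔ (⁅D.PiX ⊓ D.DeltaC, D.PiX ⊓ D.DeltaC⁆ ⊔
      Subgroup.closure ((fun y : D.PiC => y ^ D.l) '' (D.PiX ⊓ D.DeltaC : Set D.PiC))).topologicalClosure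
      = D.PiCbar := by
  refine le_antisymm (sup_le D.piCarrow_le_piCbar ((C.H_le_piXbar hX).trans D.piXbar_le_piCbar)) ?_
  rw [← h.piXbar_sup_piCarrow_eq_piCbar, ← h.piXarrow_sup_H_eq_piXbar C hX]
  exact sup_le (sup_le (D.piXarrow_le_piCarrow.trans le_sup_left) le_sup_right) le_sup_left

/-- **`[Δ_C : Δ_{C̲→}] = l²`** (`Δ_{C̲→} = Π_{C̲→} ∩ Δ_C`; `[Δ_C : Δ_{C̲→}] = [Π_C : Π_{C̲→}] = [Π_C : Π_C̲]·
[Π_C̲ : Π_{C̲→}] = l · l`), under the printed claims of p. 38 and the law `[Π_X : Π_X̲] = l`.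
([IUTchI] Cor 1.2 p.39) [claim: Mochizuki2012, status: disputed] -/
theorem ArrowCoveringClaims.relIndex_deltaCarrow_deltaC (h : D.ArrowCoveringClaims)
    (hX : D.PiXbar.relIndex D.PiX = D.l) :
    (D.piCarrow ⊓ D.DeltaC).relIndex D.DeltaC = D.l ^ 2 := by
  have key := relIndex_inf_ker_eq_relIndex D.E.aug.toMonoidHom (le_top : D.piCarrow ≤ ⊤) fun k _ => by
    obtain ⟨⟨p, hp⟩, hpk⟩ := D.aug_piCarrow_surjective (D.E.aug.toMonoidHom k)
    exact ⟨p, hp, hpk⟩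
  rw [top_inf_eq, Subgroup.relIndex_top_right, ← Subgroup.relIndex_mul_index D.piCarrow_le_piCbar,
    h.piCarrow_relindex, h.index_piCbar hX] at key
  rw [Subgroup.inf_relIndex_right, sq]
  exact key

/-- **"`l` may be recovered"** in the resp'd case: a `Θ : Π_C ⥲ Π'_C` carrying `Π_{C̲→}`, `Δ_C` onto
their counterparts forces `l = l'`. ([IUTchI] Cor 1.2 p.39) [claim: Mochizuki2012, status: disputed] -/
theorem ArrowCoveringClaims.l_eq_of_map_piCarrow_deltaC (h : D.ArrowCoveringClaims)
    (h' : D'.ArrowCoveringClaims) (hX : D.PiXbar.relIndex D.PiX = D.l)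
    (hX' : D'.PiXbar.relIndex D'.PiX = D'.l) (Θ : D.PiC ≃* D'.PiC)
    (hΘ : D.piCarrow.map Θ.toMonoidHom = D'.piCarrow) (hΘΔ : D.DeltaC.map Θ.toMonoidHom = D'.DeltaC) :
    D.l = D'.l := by
  have h1 := Subgroup.relIndex_map_map_of_injective (f := Θ.toMonoidHom) (D.piCarrow ⊓ D.DeltaC)
    D.DeltaC Θ.injective
  rw [Subgroup.map_inf _ _ _ Θ.injective, hΘ, hΘΔ, h'.relIndex_deltaCarrow_deltaC hX',
    h.relIndex_deltaCarrow_deltaC hX] at h1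
  exact (Nat.pow_left_injective two_ne_zero h1).symm

/-- **`Θ(Π_C̲) = Π'_C̲` in the resp'd case**: a bicontinuous `Θ : Π_C ⥲ Π'_C` carrying `Π_{C̲→}`, `Δ_X`,
`Δ_C` onto their counterparts carries `Π_C̲ = Π_{C̲→} · H` onto `Π'_C̲` (no splitting step needed —
"[slightly easier]"). ([IUTchI] Cor 1.2 p.39) [claim: Mochizuki2012, status: disputed] -/
theorem ArrowCoveringClaims.map_piCbar_eq_of_map_piCarrow (h : D.ArrowCoveringClaims)
    (h' : D'.ArrowCoveringClaims) (C : D.CuspGalois) (C' : D'.CuspGalois)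
    (hX : D.PiXbar.relIndex D.PiX = D.l) (hX' : D'.PiXbar.relIndex D'.PiX = D'.l)
    (Θ : D.PiC ≃* D'.PiC) (hc : Continuous Θ) (hc' : Continuous Θ.symm)
    (hΘ : D.piCarrow.map Θ.toMonoidHom = D'.piCarrow)
    (hΘX : (D.PiX ⊓ D.DeltaC).map Θ.toMonoidHom = D'.PiX ⊓ D'.DeltaC)
    (hΘΔ : D.DeltaC.map Θ.toMonoidHom = D'.DeltaC) :
    D.PiCbar.map Θ.toMonoidHom = D'.PiCbar := by
  have hl : D.l = D'.l := h.l_eq_of_map_piCarrow_deltaC h' hX hX' Θ hΘ hΘΔ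
  rw [← h.piCarrow_sup_H_eq_piCbar C hX, ← h'.piCarrow_sup_H_eq_piCbar C' hX', Subgroup.map_sup, hΘ,
    map_H_eq Θ hc hc' hΘX hl]

/-! ### The ramified cusps of `C̲→ → C̲` and their transport -/

/-- In `Δ_X̲`, `Π_{C̲→}` and `Π_{X̲→}` cut out the same subgroup (`Π_{X̲→} = Π_X̲ ∩ Π_{C̲→}`): for a
cusp `x` of `X̲`, `I_x ⊆ Π_{C̲→} ↔ I_x ⊆ Π_{X̲→}`. ([IUTchI] Cor 1.2 p.39) [claim: Mochizuki2012, status: disputed] -/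
theorem ArrowCoveringClaims.inertia_le_piCarrow_iff (h : D.ArrowCoveringClaims) (x : D.Cusp) :
    D.inertia x ≤ D.piCarrow ↔ D.inertia x ≤ D.piXarrow := by
  constructor
  · intro hle
    rw [h.cartesian]
    exact le_inf ((D.inertia_le_deltaXbar x).trans D.deltaXbar_le_piXbar) hle
  · exact fun hle => hle.trans D.piXarrow_le_piCarrow

/-- `Π_{C̲→}` is fixed by conjugation by `Π_C̲` (it is normal in `Π_C̲`, p. 38).
([IUTchI] §1 p.38) [claim: Mochizuki2012, status: disputed] -/
theorem ArrowCoveringClaims.conj_smul_piCarrow (h : D.ArrowCoveringClaims) {c : D.PiC}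
    (hc : c ∈ D.PiCbar) : MulAut.conj c • D.piCarrow = D.piCarrow :=
  haveI := h.piCarrow_normal
  conj_smul_eq_self_of_normal_subgroupOf D.piCarrow_le_piCbar hc

/-- Transport of the ramification criterion in `C̲→ → C̲` along a correspondence of decomposition groups
up to `Π'_C̲`-conjugacy: `I_x ⊄ Π_{C̲→} ↔ I'_{x'} ⊄ Π'_{C̲→}`. ([IUTchI] Cor 1.2 p.39)
[claim: Mochizuki2012, status: disputed] -/
theorem not_inertia_le_piCarrow_iff_of_map_decomp (h' : D'.ArrowCoveringClaims) (Θ : D.PiC ≃* D'.PiC)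
    (hΘ : D.piCarrow.map Θ.toMonoidHom = D'.piCarrow) (hΘΔ : D.DeltaC.map Θ.toMonoidHom = D'.DeltaC)
    {x : D.Cusp} {x' : D'.Cusp} {t' : D'.PiC} (ht' : t' ∈ D'.PiCbar)
    (hx : (D.decomp x).map Θ.toMonoidHom = MulAut.conj t' • D'.decomp x') :
    (¬ D.inertia x ≤ D.piCarrow) ↔ ¬ D'.inertia x' ≤ D'.piCarrow := by
  haveI := D'.E.normal_geom
  have hI : (D.inertia x).map Θ.toMonoidHom = MulAut.conj t' • D'.inertia x' := by
    rw [inertia, Subgroup.map_inf _ _ _ Θ.injective, hx, hΘΔ, inertia, Subgroup.smul_inf,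
      DeltaC, conj_smul_eq_self_of_normal D'.E.geom t']
  refine not_congr ?_
  rw [← Subgroup.map_le_map_iff_of_injective (f := Θ.toMonoidHom) Θ.injective, hI, hΘ,
    Subgroup.pointwise_smul_subset_iff, ← map_inv, h'.conj_smul_piCarrow (D'.PiCbar.inv_mem ht')]

/-- `{ε′, ε″} ↦ {ε′', ε″'}` in the resp'd case: among the cusps other than the zero cusps, those
ramified in `C̲→ → C̲` are exactly `ε′, ε″` (resp. `ε′', ε″'`). ([IUTchI] Cor 1.2 p.39)
[claim: Mochizuki2012, status: disputed] -/
theorem eq_ε1_or_eq_ε2_of_map_decomp_piCarrow (h : D.ArrowCoveringClaims) (h' : D'.ArrowCoveringClaims)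
    (Θ : D.PiC ≃* D'.PiC) (hΘ : D.piCarrow.map Θ.toMonoidHom = D'.piCarrow)
    (hΘΔ : D.DeltaC.map Θ.toMonoidHom = D'.DeltaC) {x : D.Cusp} (hx1 : x = D.ε1 ∨ x = D.ε2)
    {x' : D'.Cusp} (hx'0 : x' ≠ D'.ε0) {t' : D'.PiC} (ht' : t' ∈ D'.PiCbar)
    (hx : (D.decomp x).map Θ.toMonoidHom = MulAut.conj t' • D'.decomp x') :
    x' = D'.ε1 ∨ x' = D'.ε2 := by
  have hx0 : x ≠ D.ε0 := by
    rcases hx1 with rfl | rfl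
    · exact D.ε1_ne_ε0
    · exact D.ε2_ne_ε0
  have hram : ¬ D.inertia x ≤ D.piCarrow := by
    rw [h.inertia_le_piCarrow_iff]
    exact (h.not_inertia_le_piXarrow_iff hx0).mpr hx1
  have hram' := (not_inertia_le_piCarrow_iff_of_map_decomp h' Θ hΘ hΘΔ ht' hx).mp hram
  rw [h'.inertia_le_piCarrow_iff] at hram'
  exact (h'.not_inertia_le_piXarrow_iff hx'0).mp hram'

/-! ### Corollary 1.2, resp'd clause, from the printed anabelian inputs -/

/-- **Corollary 1.2, resp'd clause `Π_{C̲→}`, ASSEMBLED along the printed route** ("entirely similar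
[but slightly easier]"): for data `D, D'` satisfying the printed claims of p. 38, with cusp actions and
the law `[Π_X : Π_X̲] = l`, GIVEN — as hypotheses, never asserted — `hcoreC` (every bicontinuous
`ψ : Π_{C̲→} ⥲ Π'_{C̲→}` extends to a bicontinuous `Θ : Π_C ⥲ Π'_C` with `Θ(Δ_X) = Δ'_X`,
`Θ(Δ_C) = Δ'_C`: slimness + [AbsTopI] Thm. 2.6 (v)(vi) + [AbsTopII] Cor. 3.3 (i)(ii)) and `hLem45C`
([AbsTopI] Lem. 4.5 as amended by Rmk. 1.2.2 (ii), for the orbicurve `C̲`: a bicontinuous `Θ` with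
`Θ(Π_C̲) = Π'_C̲` carries the `Π_C̲`-classes of the decomposition groups `D_x`, `x ≠ ε⁰` [the
decomposition groups in `Π_C̲` of the cusps of `C̲` other than `ε̲⁰`, the one whose inertia does not
lie in `Δ_X`; see the module docstring's reading note] onto the corresponding classes for `C̲'`, both
directions), every bicontinuous `ψ` extends to a continuous
`Ψ : Π_C̲ ⥲ Π'_C̲` carrying the class of the decomposition groups of `ε̲` onto its counterpart.
([IUTchI] Cor 1.2 p.39) [claim: Mochizuki2012, status: disputed] -/
theorem ofCarrow_of_anabelian (h : D.ArrowCoveringClaims) (h' : D'.ArrowCoveringClaims)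
    (C : D.CuspGalois) (C' : D'.CuspGalois) (hX : D.PiXbar.relIndex D.PiX = D.l)
    (hX' : D'.PiXbar.relIndex D'.PiX = D'.l)
    (hcoreC : ∀ ψ : D.piCarrow ≃* D'.piCarrow, Continuous ψ → Continuous ψ.symm →
      ∃ Θ : D.PiC ≃* D'.PiC, Continuous Θ ∧ Continuous Θ.symm ∧
        (∀ x : D.piCarrow, Θ (x : D.PiC) = (ψ x : D'.PiC)) ∧
        (D.PiX ⊓ D.DeltaC).map Θ.toMonoidHom = D'.PiX ⊓ D'.DeltaC ∧
        D.DeltaC.map Θ.toMonoidHom = D'.DeltaC)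
    (hLem45C : ∀ Θ : D.PiC ≃* D'.PiC, Continuous Θ → Continuous Θ.symm →
      D.PiCbar.map Θ.toMonoidHom = D'.PiCbar →
        (∀ x : D.Cusp, x ≠ D.ε0 → ∃ x' : D'.Cusp, x' ≠ D'.ε0 ∧ ∃ t' ∈ D'.PiCbar,
          (D.decomp x).map Θ.toMonoidHom = MulAut.conj t' • D'.decomp x') ∧
        (∀ x' : D'.Cusp, x' ≠ D'.ε0 → ∃ x : D.Cusp, x ≠ D.ε0 ∧ ∃ t' ∈ D'.PiCbar,
          (D.decomp x).map Θ.toMonoidHom = MulAut.conj t' • D'.decomp x')) :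
    ∀ ψ : D.piCarrow ≃* D'.piCarrow, Continuous ψ → Continuous ψ.symm →
      ∃ Ψ : D.PiCbar ≃* D'.PiCbar, Continuous Ψ ∧
        (∀ (x : D.PiC) (hx : x ∈ D.piCarrow) (hx' : x ∈ D.PiCbar),
          (Ψ ⟨x, hx'⟩ : D'.PiC) = (ψ ⟨x, hx⟩ : D'.PiC)) ∧
        Subgroup.map Ψ.toMonoidHom '' D.cuspClassC = D'.cuspClassC := by
  intro ψ hψ hψ'
  obtain ⟨Θ, hc, hc', hext, hΘX, hΘΔ⟩ := hcoreC ψ hψ hψ'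
  have hΘ : D.piCarrow.map Θ.toMonoidHom = D'.piCarrow := map_eq_of_extends ψ Θ hext
  have hΘCbar : D.PiCbar.map Θ.toMonoidHom = D'.PiCbar :=
    h.map_piCbar_eq_of_map_piCarrow h' C C' hX hX' Θ hc hc' hΘ hΘX hΘΔ
  obtain ⟨hcusp, hcusp'⟩ := hLem45C Θ hc hc' hΘCbar
  obtain ⟨Ψ, hΨc, hΨ⟩ := exists_continuous_restrict_piCbar Θ hc hΘCbar
  refine ⟨Ψ, hΨc, fun x hx hx' => by rw [hΨ ⟨x, hx'⟩]; exact hext ⟨x, hx⟩,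
    image_map_subtype_transport Θ Ψ hΨ _ _ ?_⟩
  -- transport of the class of `ε̲` pushed into `Π_C`
  rw [show (fun K : Subgroup D.PiCbar => (K.map D.PiCbar.subtype).map Θ.toMonoidHom) =
      (fun L => L.map Θ.toMonoidHom) ∘ (fun K => K.map D.PiCbar.subtype) from rfl, Set.image_comp,
    image_map_subtype_cuspClassC, image_map_subtype_cuspClassC]
  -- `Θ(D_{ε′}) = (t₁ q) • D'_{ε′'}` with `t₁ q ∈ Π'_C̲`
  obtain ⟨e₁, he₁0, t₁, ht₁, he₁⟩ := hcusp D.ε1 D.ε1_ne_ε0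
  have he₁' : e₁ = D'.ε1 ∨ e₁ = D'.ε2 :=
    eq_ε1_or_eq_ε2_of_map_decomp_piCarrow h h' Θ hΘ hΘΔ (Or.inl rfl) he₁0 ht₁ he₁
  obtain ⟨q, hq, hq'⟩ := h'.exists_decomp_eq_conj_decomp_ε1 C' he₁'
  rw [hq', ← mul_smul, ← map_mul] at he₁
  have hr : t₁ * q ∈ D'.PiCbar := D'.PiCbar.mul_mem ht₁ hq
  ext L'
  simp only [Set.mem_image, Set.mem_setOf_eq]
  constructor
  · rintro ⟨L, ⟨t, ht, rfl⟩, rfl⟩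
    have hΘt : Θ.toMonoidHom t ∈ D'.PiCbar := by rw [← hΘCbar]; exact ⟨t, ht, rfl⟩
    refine ⟨Θ.toMonoidHom t * (t₁ * q), D'.PiCbar.mul_mem hΘt hr, ?_⟩
    rw [map_conj_smul, he₁, ← mul_smul, ← map_mul]
  · rintro ⟨t', ht', rfl⟩
    have hmem : t' * (t₁ * q)⁻¹ ∈ D.PiCbar.map Θ.toMonoidHom := by
      rw [hΘCbar]; exact D'.PiCbar.mul_mem ht' (D'.PiCbar.inv_mem hr)
    obtain ⟨s, hs, hst⟩ := hmem
    refine ⟨MulAut.conj s • D.decomp D.ε1, ⟨s, hs, rfl⟩, ?_⟩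
    rw [map_conj_smul, he₁, ← mul_smul, ← map_mul, hst, inv_mul_cancel_right]

/-- **Corollary 1.2 (Characteristic Nature of Coverings) with BOTH clauses derived from the printed
anabelian inputs** (non-resp'd clause: `ofXarrow_of_anabelian`; resp'd clause: `ofCarrow_of_anabelian`):
for data `D, D'` satisfying the printed claims of p. 38 (`ArrowCoveringClaims`), with cusp actions
(`CuspGalois`), the law `[Π_X : Π_X̲] = l` and the printed ramification of `ε⁰` in `X̲→ → X̲`, the typed
`CharacteristicNatureOfCoverings D D'` follows from the core-reconstruction inputs `hcore`, `hcoreC`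
[slimness, [AbsTopI] Thm. 2.6 (v)(vi), [AbsTopII] Cor. 3.3 (i)(ii)] and the cusp-transport inputs
`hLem45`, `hLem45C` [[AbsTopI] Lem. 4.5 with Rmk. 1.2.2 (ii), for `X̲` and for `C̲`] — hypotheses,
never asserted. ([IUTchI] Cor 1.2 p.39) [claim: Mochizuki2012, status: disputed] -/
theorem characteristicNatureOfCoverings_of_anabelian' (h : D.ArrowCoveringClaims)
    (h' : D'.ArrowCoveringClaims) (C : D.CuspGalois) (C' : D'.CuspGalois)
    (hX : D.PiXbar.relIndex D.PiX = D.l) (hX' : D'.PiXbar.relIndex D'.PiX = D'.l)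
    (h0 : ¬ D.inertia D.ε0 ≤ D.piXarrow) (h0' : ¬ D'.inertia D'.ε0 ≤ D'.piXarrow)
    (hcore : ∀ φ : D.piXarrow ≃* D'.piXarrow, Continuous φ → Continuous φ.symm →
      ∃ Θ : D.PiC ≃* D'.PiC, Continuous Θ ∧ Continuous Θ.symm ∧
        (∀ x : D.piXarrow, Θ (x : D.PiC) = (φ x : D'.PiC)) ∧
        (D.PiX ⊓ D.DeltaC).map Θ.toMonoidHom = D'.PiX ⊓ D'.DeltaC ∧
        D.DeltaC.map Θ.toMonoidHom = D'.DeltaC)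
    (hLem45 : ∀ Θ : D.PiC ≃* D'.PiC, Continuous Θ → Continuous Θ.symm →
      D.PiXbar.map Θ.toMonoidHom = D'.PiXbar →
        (∀ x : D.Cusp, ∃ x' : D'.Cusp, ∃ t' ∈ D'.PiXbar,
          (D.decomp x).map Θ.toMonoidHom = MulAut.conj t' • D'.decomp x') ∧
        (∀ x' : D'.Cusp, ∃ x : D.Cusp, ∃ t' ∈ D'.PiXbar,
          (D.decomp x).map Θ.toMonoidHom = MulAut.conj t' • D'.decomp x'))
    (hcoreC : ∀ ψ : D.piCarrow ≃* D'.piCarrow, Continuous ψ → Continuous ψ.symm →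
      ∃ Θ : D.PiC ≃* D'.PiC, Continuous Θ ∧ Continuous Θ.symm ∧
        (∀ x : D.piCarrow, Θ (x : D.PiC) = (ψ x : D'.PiC)) ∧
        (D.PiX ⊓ D.DeltaC).map Θ.toMonoidHom = D'.PiX ⊓ D'.DeltaC ∧
        D.DeltaC.map Θ.toMonoidHom = D'.DeltaC)
    (hLem45C : ∀ Θ : D.PiC ≃* D'.PiC, Continuous Θ → Continuous Θ.symm →
      D.PiCbar.map Θ.toMonoidHom = D'.PiCbar →
        (∀ x : D.Cusp, x ≠ D.ε0 → ∃ x' : D'.Cusp, x' ≠ D'.ε0 ∧ ∃ t' ∈ D'.PiCbar,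
          (D.decomp x).map Θ.toMonoidHom = MulAut.conj t' • D'.decomp x') ∧
        (∀ x' : D'.Cusp, x' ≠ D'.ε0 → ∃ x : D.Cusp, x ≠ D.ε0 ∧ ∃ t' ∈ D'.PiCbar,
          (D.decomp x).map Θ.toMonoidHom = MulAut.conj t' • D'.decomp x')) :
    D.CharacteristicNatureOfCoverings D' :=
  characteristicNatureOfCoverings_of_core_extensions h h'
    (ofXarrow_of_anabelian h h' C C' hX hX' h0 h0' hcore hLem45)
    (ofCarrow_of_anabelian h h' C C' hX hX' hcoreC hLem45C)

end PuncturedEllipticData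

end Literature.IUT.HodgeTheaters
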